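import Summits.Ventures.QEC.CircuitDistance.PortFibreLeaf
import HarnessLib

/-!
# P3-PORT (D3): the FIBRE REDUCTION — from UNSAT leaves to «no silent set with a nontrivial residual», and EQUIVARIANCE
# (cell `qec`, experiment CDX, seat qec-cdx-type-1)

* `TightRealisable D scope x b`: a silent in-scope set of columns projecting to the word `x` with `≤ |x| + b` columns.
* `Covers D scope enc xs L`: COVERAGE of the word `xs` (in the leaf's group order) by the leaf `L` under an injective
  detector encoding — every in-scope column of class `xs[j]` has its encoded detector set among group `j`'s coordinates,
  every in-scope null column is detector-free or among the null coordinates (discharged per instance by `decide`).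
* **`not_tightRealisable_of_leaf`**: coverage + well-formed + UNSAT + budget `≤ 1` ⇒ no tight realisation.
* **`no_silent_nontrivial`** (the fibre reduction): under `ClassHyp`, with a stabiliser-invariant non-triviality, if no
  nontrivial word `x` of weight `≤ w` is tightly realisable with budget `w − |x|`, then no silent in-scope set of `≤ w`
  columns has a nontrivial residual.
* `Symmetry` (compatible bijections of columns/detectors/generators) and **`tightRealisable_map_iff`**: orbit
  representatives suffice.
Generic; nothing here mentions a circuit.
-/

namespace Summit.Ventures.QEC.CircuitDistance.Fibre

open Finset

variable {ι δ γ V : Type*} [DecidableEq ι] [DecidableEq δ] [DecidableEq γ]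
variable [AddCommGroup V] [Module (ZMod 2) V]

/-! ## From leaves to the DEM -/

/-- `x` is TIGHTLY REALISABLE with budget `b`: some silent in-scope set of columns projects to `x` and has `≤ |x| + b`
columns. -/
def TightRealisable (D : DEM ι δ γ V) (scope : Set ι) (x : Finset γ) (b : ℕ) : Prop :=
  ∃ F : Finset ι, (∀ i ∈ F, i ∈ scope) ∧ Silent D F ∧ proj D F = x ∧ F.card ≤ x.card + b

/-- COVERAGE of the word `xs` (listed in the leaf's group order) by the leaf `L` under the detector encoding `enc`. -/
def Covers (D : DEM ι δ γ V) (scope : Set ι) (enc : δ → ℕ) (xs : List γ) (L : Leaf) : Prop :=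
  Function.Injective enc ∧ xs.length = L.k ∧
  (∀ i ∈ scope, ∀ j : Fin xs.length, D.cls i = some xs[j] →
      ∃ c ∈ L.group j, (L.coordsOf c).toFinset = (D.det i).image enc) ∧
  (∀ i ∈ scope, D.cls i = none → D.det i = ∅ ∨ ∃ c ∈ L.nulls, (L.coordsOf c).toFinset = (D.det i).image enc)

/-- **No tight realisation from an UNSAT leaf** (budget `≤ 1`: then a tight set is exactly one column per generator of
the word plus at most one null column, `tight_of_budget_le_one`, and coverage turns it into a realisation of the leaf). -/
theorem not_tightRealisable_of_leaf (D : DEM ι δ γ V) (scope : Set ι) (enc : δ → ℕ) (xs : List γ)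
    (hxs : xs.Nodup) (L : Leaf) (hcov : Covers D scope enc xs L) (hwf : L.wf = true)
    (h : (Census.CNFEncode.cnfEncodeAny L.n L.rows L.us L.w).Unsat) (hb : L.budget ≤ 1) :
    ¬ TightRealisable D scope xs.toFinset L.budget := by
  classical
  obtain ⟨henc, hlen, hcovG, hcovN⟩ := hcov
  rintro ⟨F, hscope, hsil, hproj, hcard⟩
  have hxcard : xs.toFinset.card = xs.length := List.toFinset_card_of_nodup hxs
  have htight := tight_of_budget_le_one D F (by rw [hproj]; omega)
  obtain ⟨h1, h2, h3⟩ := htight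
  have hcardk : F.card ≤ L.k + L.budget := by rw [hxcard, hlen] at hcard; exact hcard
  have h3k : nullCount D F + L.k = F.card := by rw [hproj, hxcard, hlen] at h3; exact h3
  have hjlt : ∀ j : Fin L.k, (j : ℕ) < xs.length := fun j => j.2.trans_eq hlen.symm
  -- the unique column of each generator of the word
  have hmem : ∀ j : Fin L.k, xs[(j : ℕ)]'(hjlt j) ∈ proj D F := by
    intro j; rw [hproj, List.mem_toFinset]; exact List.getElem_mem _
  have hex : ∀ j : Fin L.k, ∃ i, F.filter (fun i => D.cls i = some (xs[(j : ℕ)]'(hjlt j))) = {i} :=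
    fun j => Finset.card_eq_one.1 (h1 _ (hmem j))
  choose col hcol using hex
  have hcol_mem : ∀ j, col j ∈ F ∧ D.cls (col j) = some (xs[(j : ℕ)]'(hjlt j)) := by
    intro j
    have : col j ∈ F.filter (fun i => D.cls i = some (xs[(j : ℕ)]'(hjlt j))) := by
      rw [hcol j]; exact Finset.mem_singleton_self _
    exact Finset.mem_filter.1 this
  have hcol_inj : Function.Injective col := by
    intro j j' hjj'
    have e := (hcol_mem j).2.symm.trans (hjj' ▸ (hcol_mem j').2)
    have e' := Option.some_injective _ e
    have := (List.Nodup.getElem_inj_iff hxs).1 e'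
    exact Fin.ext this
  -- every non-null column of F is some `col j`
  have hnonnull : ∀ i ∈ F, D.cls i ≠ none → ∃ j, i = col j := by
    intro i hi hne
    obtain ⟨g, hg⟩ := Option.ne_none_iff_exists'.1 hne
    have hgproj : g ∈ proj D F := by
      by_contra hng
      have := h2 g hng
      unfold mult at this
      rw [Finset.card_eq_zero, Finset.filter_eq_empty_iff] at this
      exact this hi hg
    rw [hproj, List.mem_toFinset] at hgproj
    obtain ⟨jn, hjn, rfl⟩ := List.getElem_of_mem hgproj
    refine ⟨⟨jn, hjn.trans_eq hlen⟩, ?_⟩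
    have : i ∈ F.filter (fun i' => D.cls i' = some (xs[jn]'hjn)) := Finset.mem_filter.2 ⟨hi, hg⟩
    rw [hcol ⟨jn, hjn.trans_eq hlen⟩] at this
    exact Finset.mem_singleton.1 this
  -- coverage: coordinates for the generator columns
  have hpickex : ∀ j : Fin L.k, ∃ c ∈ L.group j, (L.coordsOf c).toFinset = (D.det (col j)).image enc := by
    intro j
    exact hcovG (col j) (hscope _ (hcol_mem j).1) ⟨j, hjlt j⟩ (hcol_mem j).2
  choose pick hpick hpickc using hpickex
  -- the null part
  set P := F.filter (fun i => D.cls i = none) with hP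
  have hPcard : P.card ≤ 1 := by
    have : P.card = nullCount D F := rfl
    omega
  -- F = image col ∪ P
  have hFsplit : F = (Finset.univ.image col) ∪ P := by
    ext i
    simp only [Finset.mem_union, Finset.mem_image, Finset.mem_univ, true_and, hP, Finset.mem_filter]
    constructor
    · intro hi
      by_cases hc : D.cls i = none
      · exact Or.inr ⟨hi, hc⟩
      · obtain ⟨j, rfl⟩ := hnonnull i hi hc; exact Or.inl ⟨j, rfl⟩
    · rintro (⟨j, rfl⟩ | ⟨hi, -⟩)
      · exact (hcol_mem j).1
      · exact hi
  have hdisj : Disjoint (Finset.univ.image col) P := by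
    rw [Finset.disjoint_left]
    intro i hi hiP
    obtain ⟨j, -, rfl⟩ := Finset.mem_image.1 hi
    have := (Finset.mem_filter.1 hiP).2
    rw [(hcol_mem j).2] at this
    exact Option.some_ne_none _ this
  -- count of a detector over the generator columns
  have hcount_gen : ∀ d : ℕ, ((Finset.univ.image col).filter fun i => d ∈ (D.det i).image enc).card =
      (Finset.univ.filter fun j : Fin L.k => d ∈ L.coordsOf (pick j)).card := by
    intro d
    rw [Finset.filter_image, Finset.card_image_of_injective _ hcol_inj]
    congr 1
    ext j
    simp only [Finset.mem_filter, Finset.mem_univ, true_and]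
    rw [← List.mem_toFinset, hpickc j]
  -- the encoded silence
  have hsilenc : ∀ d : ℕ, Even ((F.filter fun i => d ∈ (D.det i).image enc).card) := by
    intro d
    by_cases hd : ∃ d', enc d' = d
    · obtain ⟨d', rfl⟩ := hd
      have : (F.filter fun i => enc d' ∈ (D.det i).image enc) = F.filter fun i => d' ∈ D.det i := by
        apply Finset.filter_congr
        intro i _
        rw [Finset.mem_image]
        constructor
        · rintro ⟨d'', h1, h2⟩; exact henc h2 ▸ h1
        · intro h1; exact ⟨d', h1, rfl⟩
      rw [this]; exact hsil d'
    · have : (F.filter fun i => d ∈ (D.det i).image enc) = ∅ := by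
        rw [Finset.filter_eq_empty_iff]
        intro i _ hmem
        obtain ⟨d', -, hd'⟩ := Finset.mem_image.1 hmem
        exact hd ⟨d', hd'⟩
      rw [this]; exact ⟨0, rfl⟩
  -- build the realisation, by cases on the null part
  apply Leaf.not_realised_of_unsat L hwf h
  rcases Nat.lt_or_ge P.card 1 with hP0 | hP1
  · -- no null column
    have hPe : P = ∅ := Finset.card_eq_zero.1 (by omega)
    refine ⟨pick, ∅, hpick, by simp, by simp, ?_⟩
    intro d
    have := hsilenc d
    rw [hFsplit, Finset.filter_union, Finset.card_union_of_disjoint (Finset.disjoint_filter_filter hdisj),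
      hcount_gen, hPe] at this
    simpa using this
  · -- exactly one null column
    have hP1' : P.card = 1 := le_antisymm hPcard hP1
    obtain ⟨p, hp⟩ := Finset.card_eq_one.1 hP1'
    have hpF : p ∈ F ∧ D.cls p = none := by
      have : p ∈ P := by rw [hp]; exact Finset.mem_singleton_self _
      exact Finset.mem_filter.1 this
    rcases hcovN p (hscope p hpF.1) hpF.2 with hdet | ⟨c, hcn, hcc⟩
    · -- detector-free null column: contributes nothing
      refine ⟨pick, ∅, hpick, by simp, by simp, ?_⟩
      intro d
      have := hsilenc d
      rw [hFsplit, Finset.filter_union, Finset.card_union_of_disjoint (Finset.disjoint_filter_filter hdisj),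
        hcount_gen, hp] at this
      have h0 : (({p} : Finset ι).filter fun i => d ∈ (D.det i).image enc).card = 0 := by
        rw [Finset.card_eq_zero, Finset.filter_eq_empty_iff]
        intro i hi
        rw [Finset.mem_singleton.1 hi, hdet]; simp
      rw [h0] at this
      simpa using this
    · refine ⟨pick, {c}, hpick, by simpa using hcn, ?_, ?_⟩
      · have hPn : P.card = nullCount D F := rfl
        have : 1 ≤ L.budget := by omega
        simpa using this
      · intro d
        have := hsilenc d
        rw [hFsplit, Finset.filter_union, Finset.card_union_of_disjoint (Finset.disjoint_filter_filter hdisj),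
          hcount_gen, hp] at this
        have hc1 : (({c} : Finset ℕ).filter fun c' => d ∈ L.coordsOf c').card =
            (({p} : Finset ι).filter fun i => d ∈ (D.det i).image enc).card := by
          by_cases hd : d ∈ L.coordsOf c
          · have hd' : d ∈ (D.det p).image enc := by rw [← hcc]; exact List.mem_toFinset.2 hd
            rw [Finset.filter_singleton, Finset.filter_singleton, if_pos hd, if_pos hd']
            simp
          · have hd' : d ∉ (D.det p).image enc := by rw [← hcc]; exact fun h => hd (List.mem_toFinset.1 h)
            have e1 : (({c} : Finset ℕ).filter fun c' => d ∈ L.coordsOf c') = ∅ := by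
              rw [Finset.filter_singleton, if_neg hd]
            have e2 : (({p} : Finset ι).filter fun i => d ∈ (D.det i).image enc) = ∅ := by
              rw [Finset.filter_singleton, if_neg hd']
            rw [e1, e2, Finset.card_empty, Finset.card_empty]
        rw [hc1]; exact this

/-! ## The fibre reduction -/

/-- **FIBRE REDUCTION (abstract).** Under `ClassHyp`, with a stabiliser-invariant notion of non-triviality, if no
nontrivial word `x` of weight `≤ w` is tightly realisable with budget `w − |x|`, then no silent in-scope set of `≤ w`
columns has a nontrivial residual. -/
theorem no_silent_nontrivial (D : DEM ι δ γ V) (scope : Set ι) (hD : ClassHyp D scope)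
    (Nontrivial : V → Prop) (hN : ∀ v s, s ∈ D.stab → (Nontrivial (v + s) ↔ Nontrivial v)) (w : ℕ)
    (hfibre : ∀ x : Finset γ, Nontrivial (wordVec D x) → x.card ≤ w → ¬ TightRealisable D scope x (w - x.card)) :
    ∀ F : Finset ι, (∀ i ∈ F, i ∈ scope) → F.card ≤ w → Silent D F → ¬ Nontrivial (resOf D F) := by
  intro F hF hcard hsil hnt
  have hmem := proj_res_mem D hD F hF
  have hx : Nontrivial (wordVec D (proj D F)) := by
    have : wordVec D (proj D F) = resOf D F + (wordVec D (proj D F) - resOf D F) := by abel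
    rw [this, hN]
    · exact hnt
    · have : wordVec D (proj D F) - resOf D F = -(resOf D F - wordVec D (proj D F)) := by abel
      rw [this]; exact D.stab.neg_mem hmem
  have hxcard : (proj D F).card ≤ w := le_trans (Nat.le_add_right _ _) ((proj_card_add_null_le D F).trans hcard)
  exact hfibre _ hx hxcard ⟨F, hF, hsil, rfl, by omega⟩

/-! ## Equivariance -/

/-- A SYMMETRY of a DEM: bijections of columns, detectors and generators compatible with `det`, `cls` and the scope. -/
structure Symmetry (D : DEM ι δ γ V) (scope : Set ι) where
  /-- action on columns -/
  onCol : ι ≃ ι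
  /-- action on detectors -/
  onDet : δ ≃ δ
  /-- action on generators -/
  onGen : γ ≃ γ
  /-- detector sets are transported -/
  det_map : ∀ i, D.det (onCol i) = (D.det i).map onDet.toEmbedding
  /-- classes are transported -/
  cls_map : ∀ i, D.cls (onCol i) = (D.cls i).map onGen
  /-- the scope is invariant -/
  scope_map : ∀ i, onCol i ∈ scope ↔ i ∈ scope

/-- The inverse symmetry. -/
def Symmetry.symm {D : DEM ι δ γ V} {scope : Set ι} (σ : Symmetry D scope) : Symmetry D scope where
  onCol := σ.onCol.symm
  onDet := σ.onDet.symm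
  onGen := σ.onGen.symm
  det_map := by
    intro i
    have h := σ.det_map (σ.onCol.symm i)
    rw [Equiv.apply_symm_apply] at h
    ext d
    rw [Finset.mem_map_equiv, h, Finset.mem_map_equiv, Equiv.symm_symm, Equiv.symm_apply_apply]
  cls_map := by
    intro i
    have h := σ.cls_map (σ.onCol.symm i)
    rw [Equiv.apply_symm_apply] at h
    rw [h, Option.map_map]
    have : (⇑σ.onGen.symm ∘ ⇑σ.onGen) = id := σ.onGen.symm_comp_self
    rw [this, Option.map_id, id]
  scope_map := by
    intro i
    have h := σ.scope_map (σ.onCol.symm i)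
    rw [Equiv.apply_symm_apply] at h
    exact h.symm

omit [DecidableEq ι] [DecidableEq δ] in
/-- Multiplicities are transported by a symmetry. -/
theorem mult_map (D : DEM ι δ γ V) {scope : Set ι} (σ : Symmetry D scope) (F : Finset ι) (g : γ) :
    mult D (F.map σ.onCol.toEmbedding) (σ.onGen g) = mult D F g := by
  unfold mult
  rw [Finset.filter_map, Finset.card_map]
  congr 1
  apply Finset.filter_congr
  intro i _
  simp only [Function.comp, Equiv.coe_toEmbedding, σ.cls_map]
  cases D.cls i with
  | none => simp
  | some g' => simp [σ.onGen.injective.eq_iff]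

omit [DecidableEq ι] [DecidableEq δ] in
/-- Projections are transported by a symmetry. -/
theorem proj_map (D : DEM ι δ γ V) {scope : Set ι} (σ : Symmetry D scope) (F : Finset ι) :
    proj D (F.map σ.onCol.toEmbedding) = (proj D F).map σ.onGen.toEmbedding := by
  ext g
  rw [Finset.mem_map_equiv, mem_proj, mem_proj]
  have := mult_map D σ F (σ.onGen.symm g)
  rw [Equiv.apply_symm_apply] at this
  rw [this]

omit [DecidableEq ι] [DecidableEq γ] in
/-- Silence is transported by a symmetry. -/
theorem silent_map (D : DEM ι δ γ V) {scope : Set ι} (σ : Symmetry D scope) (F : Finset ι) (h : Silent D F) :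
    Silent D (F.map σ.onCol.toEmbedding) := by
  intro d
  rw [Finset.filter_map, Finset.card_map]
  have : F.filter ((fun i => d ∈ D.det i) ∘ σ.onCol.toEmbedding) = F.filter fun i => σ.onDet.symm d ∈ D.det i := by
    apply Finset.filter_congr
    intro i _
    simp only [Function.comp, Equiv.coe_toEmbedding, σ.det_map, Finset.mem_map_equiv]
  rw [this]; exact h _

omit [DecidableEq ι] in
/-- Tight realisability is transported by a symmetry. -/
theorem tightRealisable_map (D : DEM ι δ γ V) (scope : Set ι) (σ : Symmetry D scope) (x : Finset γ) (b : ℕ)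
    (h : TightRealisable D scope x b) : TightRealisable D scope (x.map σ.onGen.toEmbedding) b := by
  obtain ⟨F, hF, hsil, hproj, hcard⟩ := h
  refine ⟨F.map σ.onCol.toEmbedding, ?_, silent_map D σ F hsil, ?_, ?_⟩
  · intro i hi
    rw [Finset.mem_map_equiv] at hi
    have := hF _ hi
    rwa [← σ.scope_map, Equiv.apply_symm_apply] at this
  · rw [proj_map, hproj]
  · rw [Finset.card_map, Finset.card_map]; exact hcard

omit [DecidableEq ι] in
/-- **EQUIVARIANCE.** Tight realisability of a word is invariant under a symmetry; so a per-word leaf for one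
representative of each orbit suffices. -/
theorem tightRealisable_map_iff (D : DEM ι δ γ V) (scope : Set ι) (σ : Symmetry D scope) (x : Finset γ) (b : ℕ) :
    TightRealisable D scope (x.map σ.onGen.toEmbedding) b ↔ TightRealisable D scope x b := by
  constructor
  · intro h
    have := tightRealisable_map D scope σ.symm _ b h
    rw [Finset.map_map] at this
    have e : σ.onGen.toEmbedding.trans σ.symm.onGen.toEmbedding = Function.Embedding.refl γ := by
      ext g; simp [Symmetry.symm]
    rwa [e, Finset.map_refl] at this
  · exact tightRealisable_map D scope σ x b

end Summit.Ventures.QEC.CircuitDistance.Fibre
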